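import Summits.HodgeConjecture.HodgeConjecture.Theorems.F0P6dConnectedBTDictionary   -- ★ p850278: the re-homed twin of ED. 4 675dbed9a71d921a (namespace KEPT ⇒ every FQN unchanged)
import HarnessLib
import HarnessLib.Audit.LibrarySuggestionsDenyListCruxes

/-! # F0_P6d_ConnectedBTDictionary — ED. 5 = SHIM (rung-0 re-home; LEAD «M-72» (4) ∕ «M-78» CLASS I-b, P6d batch-2; desk F0P6d-plan (g6); HOME-only cand — NOTHING is written before the LEAD's word)

Every declaration of ED. 4 (sha16 675dbed9a71d921a, 175 l., code-`sorry`-free; 8 declarations `ConnectedDimOneIsOModuleLaw`, `KernelSubfunctorOfHeight`,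
`OrdSSKernelsOnBT`, `stub_HLD`, `stub_HLE`, `tangentChar_uniformizer_eq_zero`, `ordSSKernelsOnBT_of_stubs`, `stub_HLBT_holds`) now lives, byte for byte
and under the SAME namespace `Summit.HodgeConjecture.HodgeConjecture.Cruxes.HLiu418.F0P6dConnectedBTDictionary`, in ★ `Theorems/F0P6dConnectedBTDictionary.lean`
(p850278, LA7-p02 (g3); its `Lines` import `F0_P6d_FormalModuleKernels` switched there to the ★ twin `Theorems.F0P6dFormalModuleKernels` p850166).
This module keeps its name so that importers (`rg` 2026-09-02T19:1xZ: none under `Lines/`) and by-name readers resolve unchanged through the import above;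
it declares nothing. No declaration was cut in the ★ twin (verbatim re-home) ⇒ nothing to alias. After this edition the whole P6d lineage
{`F0_P6d_FormalModuleKernels` ED. 4, `F0_P6d_LubinTateFormalModuli` ED. 6, `F0_P6d_ConnectedBTDictionary` ED. 5, `F0_P6d_BlockDocking` ED. 8} is import-only over ★
(NO-CROSS-IMPORT, «M-72» (3): no environment holds a `Lines/` original of this chain together with its ★ twin). Edition history stays in the line card
`Lines/F0_P6d_ConnectedBTDictionary.md` and in git; future changes are ★-side proposals on the `Theorems/` file. Retired Row-4B road (superseded by road P″∕HEART).
HC_CM is proved only modulo the printed citations (2 remaining named inputs: hLiu418 = stmt-HodgeConjecture-24832, h413 = stmt-HodgeConjecture-24833) until rung 0 closes;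
count-neutral (0 `sorry`, 0 socket); nothing in this file is about HC. -/
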